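import Literature.Computability.AlgebraicComplexity.BurgisserTransfer
import Literature.Computability.AlgebraicComplexity.PermanentCompleteness
import HarnessLib

/-!
# The algebraic input of Bürgisser's Theorem 2.10: `2^{p(n)} f_n = per(B_n)` for `(f_n) ∈ VNP⁰`

Bürgisser, *On defining integers and proving arithmetic circuit lower bounds* (ECCC TR06-113
= STACS 2007 = Comput. Complexity 18 (2009); ECCC numbering quoted), Thm. 2.10 (= Koiran 2004,
Thm. 4.3, in `τ`-form) is vendored in `BurgisserTransfer.lean` as the named fact
`Burgisser2009_thm210`:

  "Suppose `τ(Per_n) = n^{O(1)}`. Then for any family `(f_n) ∈ VNP⁰` there exists a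
  polynomially bounded sequence `(p(n))` in `ℕ` such that `τ(2^{p(n)} f_n) = n^{O(1)}`."

Its printed proof (ECCC TR06-113, p. 8) is one sentence of algebra plus one line of
`τ`-calculus: "An inspection of Valiant's algebraic completeness result (see for instance
[Bürgisser 2000]) reveals that any family `(f_n)` in `VNP⁰` can be expressed as a projection
`f_n = Per_{p(n)}(y_1, …, y_{p(n)²})`, where `p(n)` is polynomially bounded in `n` and the `y_i`
are either variables or constants taken from `{-1, -1/2, 0, 1/2, 1}`. By homogeneity of the
permanent we get `2^{p(n)} f_n = Per_{p(n)}(2y_1, …, 2y_{p(n)²})`."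

This file separates the two (D-0014, decomposition of an XL fact):

* `Burgisser2009_perProjection` — the "inspection" statement in its division-free form over
  `ℤ` (NAMED FACT; DISCHARGED as `Burgisser2009_perProjection_holds` in the sibling
  `BurgisserThm210Proofs.lean` from the constant-free completeness proof assembled in
  `VP0Normal.lean`, `TokenCircuits.lean`, `TokenExpansion*.lean`, `FactorSystems.lean`,
  `ValiantKitBlocks.lean` and `Literature/LinearAlgebra/Matrix/PermanentBooleanSum*.lean`):
  for `(f_n) ∈ VNP⁰` there is a p-bounded `p` and `p(n) × p(n)` matrices `B_n` whose entries
  are `2 X_v` or integer constants, with `per(B_n) = 2^{p(n)} f_n`;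
* `Burgisser2009_thm210_of : Burgisser2009_perProjection → Burgisser2009_thm210` — the
  `τ`-calculus, PROVED: `τ(2^{p(n)} f_n) = τ(per B_n) ≤ τ(Per_{p(n)}) + ∑_{ij} τ((B_n)_{ij})`
  (substitution, `constantFreeComplexity_aeval_le`), and the right-hand side is p-bounded when
  `τ(Per_n)` is.

## The entries of `B_n` (a deviation forced by the tree's `VP⁰`, documented)

In the source the constant entries `2 y_i` lie in `{-2, -1, 0, 1, 2}`. The tree's class
`IsVP0Family` (`ConstantFreeValiant.lean`) is slightly LARGER than Bürgisser's `VP⁰`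
(Def. 2.7): its formal degree gives the EMPTY sum and product gates of the list-based circuit
model formal degree `0` (Bürgisser's model has no such gates; his constants are input nodes of
formal degree `1`), so a tree-`VP⁰` circuit may build integer constants of exponential bitsize
at formal degree `0` — e.g. `f_n = 3^{2^n} X_1` is a tree-`VP⁰` (hence tree-`VNP⁰`) family
(`g_0 = ∏ ∅ = 1`, `g_1 = g_0 + g_0`, `g_2 = g_1 + g_0 = 3`, `n` squarings, one product with
`X_1`; size `n + 3`, formal degree `1`). For this family no `B_n` with entries in
`{2X_v} ∪ {-2, …, 2}` exists (the coefficients of such a permanent are `≤ p(n)! 2^{p(n)}`), but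
Thm. 2.10 itself stays true (`τ(3^{2^n}) = O(n)`). Accordingly `Burgisser2009_perProjection`
allows as constant entries all integers `c` with `τ(c) ≤ p(n)`; for families in Bürgisser's
`VNP⁰` proper (all gates of positive formal degree) the construction yields `c ∈ {-2, …, 2}`
(`τ(c) ≤ 1`), which is the printed statement. The assembly `Burgisser2009_thm210_of` only
needs `∑_{ij} τ((B_n)_{ij})` to be p-bounded, which both forms give.

## References

* P. Bürgisser, *On defining integers and proving arithmetic circuit lower bounds*, Comput.
  Complexity 18 (2009) 81–103 = ECCC TR06-113, Def. 2.7, Def. 2.8, Thm. 2.10 and its proof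
  (p. 8).
* P. Koiran, *Valiant's model and the cost of computing integers*, Comput. Complexity 13
  (2004) 131–146, Thm. 4.3.
* P. Bürgisser, M. Clausen, M. A. Shokrollahi, *Algebraic Complexity Theory*, Springer 1997,
  Thm. (21.26), Thm. (21.27), Thm. (21.29) (Valiant's completeness proof that is inspected).
* G. Malod, N. Portier, *Characterizing Valiant's algebraic complexity classes*, J. Complexity
  24 (2008) 16–38, Thm. 2 (`VNP = VNP_e` over any ring, constant-free parse-tree proof).
-/

noncomputable section

open MvPolynomial

namespace Literature.Computability.AlgebraicComplexity

/-! ### The named fact: `VNP⁰` families are scaled permanents of cheap matrices -/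

/-- An admissible entry of the matrices `B_n` of `Burgisser2009_perProjection`: twice a
variable, `2 X_v` (the source's `2 y_i` with `y_i` a variable), or an integer constant `c` of
`τ`-complexity at most `q` (the source's `2 y_i ∈ {-2, -1, 0, 1, 2}` have `τ ≤ 1`; general cheap
constants are forced because the tree's `VP⁰` gives empty gates formal degree `0` and so
contains families like `3^{2^n} X_1`, see the module docstring). [cite: Burgisser2006, proof of Thm. 2.10] -/
def IsPerProjectionEntry {σ : Type} (q : ℕ) (a : MvPolynomial σ ℤ) : Prop :=
  (∃ v : σ, a = C 2 * X v) ∨ ∃ c : ℤ, a = C c ∧ constantFreeComplexity (C c : MvPolynomial σ ℤ) ≤ q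

/-- **The algebraic content of Bürgisser's Thm. 2.10 (= Koiran 2004, Thm. 4.3), division-free
form.** "An inspection of Valiant's algebraic completeness result reveals that any family `(f_n)`
in `VNP⁰` can be expressed as a projection `f_n = Per_{p(n)}(y_1, …, y_{p(n)²})`, where `p(n)` is
polynomially bounded in `n` and the `y_i` are either variables or constants taken from
`{-1, -1/2, 0, 1/2, 1}`. By homogeneity of the permanent we get
`2^{p(n)} f_n = Per_{p(n)}(2y_1, …, 2y_{p(n)²})`" (ECCC TR06-113, proof of Thm. 2.10). Rendered
over `ℤ`: for every `VNP⁰` family `f` (tree class `IsVNP0Family`, variables `σ n`) there is a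
p-bounded `p` and, for every `n`, a `p(n) × p(n)` matrix `B_n` over `ℤ[X]` all of whose entries
are `2 X_v` or integer constants of `τ`-complexity `≤ p(n)` (`IsPerProjectionEntry`; `{-2,…,2}`
in the source, see the module docstring) such that `per(B_n) = 2^{p(n)} · f_n`. Named fact
(D-0014), the hypothesis of `Burgisser2009_thm210_of`. [cite: Burgisser2006, proof of Thm. 2.10] -/
def Burgisser2009_perProjection : Prop :=
  ∀ (σ : ℕ → Type) [∀ n, Fintype (σ n)] (f : ∀ n, MvPolynomial (σ n) ℤ), IsVNP0Family f →
    ∃ p : ℕ → ℕ, IsPBounded p ∧ ∀ n,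
      ∃ B : Matrix (Fin (p n)) (Fin (p n)) (MvPolynomial (σ n) ℤ),
        (∀ i j, IsPerProjectionEntry (p n) (B i j)) ∧ B.permanent = C ((2 : ℤ) ^ p n) * f n

/-! ### `τ`-calculus: the permanent of a matrix of cheap entries is cheap if `τ(Per)` is -/

/-- The permanent of an `N × N` matrix `B` over `ℤ[X]` is the substitution instance of the
generic permanent `Per_N` at the entries of `B`. [cite: BurgisserClausenShokrollahi1997, (21.12)] -/
theorem aeval_entries_perPoly {σ : Type*} {N : ℕ} (B : Matrix (Fin N) (Fin N) (MvPolynomial σ ℤ)) :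
    aeval (fun ij : Fin N × Fin N => B ij.1 ij.2) (perPoly (Fin N) ℤ) = B.permanent := by
  unfold perPoly
  rw [← AlgHom.coe_toRingHom, ← Matrix.permanent_map_ringHom]
  congr 1
  ext i j
  simp [Matrix.map_apply, Matrix.mvPolynomialX_apply]

/-- `τ(per B) ≤ τ(Per_N) + ∑_{ij} τ(B_{ij})`: plug circuits for the entries into a circuit for
the generic permanent (Bürgisser 2000, Rem. 2.7; the step "`τ(2^{p(n)} f_n) = n^{O(1)}`" of the
proof of ECCC TR06-113, Thm. 2.10). [cite: Burgisser2006, proof of Thm. 2.10] -/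
theorem constantFreeComplexity_permanent_le {σ : Type*} {N : ℕ}
    (B : Matrix (Fin N) (Fin N) (MvPolynomial σ ℤ)) :
    constantFreeComplexity B.permanent ≤
      constantFreeComplexity (perPoly (Fin N) ℤ) + ∑ ij : Fin N × Fin N, constantFreeComplexity (B ij.1 ij.2) := by
  rw [← aeval_entries_perPoly]
  exact constantFreeComplexity_aeval_le _ _

/-- An admissible entry costs at most `q + 2`: `τ(2 X_v) ≤ τ(2) + τ(X_v) + 1 ≤ 2` and
`τ(c) ≤ q`. [cite: Burgisser2006, proof of Thm. 2.10] -/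
theorem IsPerProjectionEntry.constantFreeComplexity_le {σ : Type} {q : ℕ} {a : MvPolynomial σ ℤ}
    (h : IsPerProjectionEntry q a) : constantFreeComplexity a ≤ q + 2 := by
  rcases h with ⟨v, rfl⟩ | ⟨c, rfl, hc⟩
  · calc constantFreeComplexity (C 2 * X v : MvPolynomial σ ℤ)
        ≤ constantFreeComplexity (C 2 : MvPolynomial σ ℤ) + constantFreeComplexity (X v : MvPolynomial σ ℤ) + 1 :=
          constantFreeComplexity_mul_le _ _
      _ ≤ 1 + 0 + 1 := by
          gcongr
          · exact constantFreeComplexity_C_two_le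
          · exact (constantFreeComplexity_X v).le
      _ ≤ q + 2 := by omega
  · exact hc.trans (Nat.le_add_right _ _)

/-- The cost of a matrix with admissible entries: `τ(per B) ≤ τ(Per_N) + N² (q + 2)`. [cite: Burgisser2006, proof of Thm. 2.10] -/
theorem constantFreeComplexity_permanent_le_of_entries {σ : Type} {N q : ℕ}
    (B : Matrix (Fin N) (Fin N) (MvPolynomial σ ℤ)) (hB : ∀ i j, IsPerProjectionEntry q (B i j)) :
    constantFreeComplexity B.permanent ≤ constantFreeComplexity (perPoly (Fin N) ℤ) + N * N * (q + 2) := by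
  refine (constantFreeComplexity_permanent_le B).trans (Nat.add_le_add_left ?_ _)
  calc ∑ ij : Fin N × Fin N, constantFreeComplexity (B ij.1 ij.2)
      ≤ ∑ _ij : Fin N × Fin N, (q + 2) := Finset.sum_le_sum fun ij _ => (hB ij.1 ij.2).constantFreeComplexity_le
    _ = N * N * (q + 2) := by simp [Finset.card_univ, Fintype.card_prod, Fintype.card_fin]

/-! ### Assembly: Theorem 2.10 from the inspection statement -/

/-- **Bürgisser's Theorem 2.10 from its algebraic input** (ECCC TR06-113, proof of Thm. 2.10):
if every `VNP⁰` family satisfies `2^{p(n)} f_n = per(B_n)` with `B_n` a `p(n) × p(n)` matrix of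
entries `2X_v` / cheap constants (`Burgisser2009_perProjection`), then `τ(Per_n) = n^{O(1)}`
implies `τ(2^{p(n)} f_n) = n^{O(1)}`: indeed
`τ(2^{p(n)} f_n) = τ(per B_n) ≤ τ(Per_{p(n)}) + p(n)² (p(n) + 2)`, a p-bounded function of `n`
(composition, products and sums of p-bounded functions). [cite: Burgisser2006, Thm. 2.10] -/
theorem Burgisser2009_thm210_of (h : Burgisser2009_perProjection) : Burgisser2009_thm210 := by
  intro hPer σ _ f hf
  obtain ⟨p, hp, hB⟩ := h σ f hf
  refine ⟨p, hp, ?_⟩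
  -- the p-bounded majorant `τ(Per_{p n}) + p n * p n * (p n + 2)`
  have hmaj : IsPBounded fun n =>
      constantFreeComplexity (perPoly (Fin (p n)) ℤ) + p n * p n * (p n + 2) :=
    IsPBounded.add_holds (IsPBounded.comp_holds hPer hp)
      (IsPBounded.mul_holds (IsPBounded.mul_holds hp hp) (IsPBounded.add_holds hp (IsPBounded.const 2)))
  refine hmaj.mono fun n => ?_
  obtain ⟨B, hBe, hBper⟩ := hB n
  rw [← hBper]
  exact constantFreeComplexity_permanent_le_of_entries B hBe

end Literature.Computability.AlgebraicComplexity
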